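import Summits.QuantumFields.BalabanUV.Beta.CompositeCorrectorKernel
import Summits.QuantumFields.BalabanUV.Beta.CompositeCorrectorCovariance
import Summits.QuantumFields.BalabanUV.Beta.AxialCoordinateProjectorCoarse

/-!
# `BalabanUV.Beta.CompositeCorrectorRules` — binder row D1, work item K-U3d leaf L3: **THE FOUR KERNEL IDENTITIES OF THE (a1*)_m CORRECTORS** —
# `Ψ̂_m ∘ Φ̂_m = 1 = Φ̂_m ∘ Ψ̂_m` and the rooted-axial (comb) slice rules `(E ∘ Ψ̂_m) ∘ E = Ψ̂_m ∘ E`, `(E ∘ Φ̂_m) ∘ E = Φ̂_m ∘ E` for `E = axEc (toSite s) (L^m)`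
# — EXACTLY the corrector inputs of K-U3c `RelInvCongruenceKernel.relInv_congr_kernel` (β sub-cell, BINDER-OWNERS row D1; cross-lane idle seat
# `b2b-balaban-t4-ne9-formalise-leaf-09` gen 39 on the row-D1 OWNER an2-g24's leaf list `HOME/b2b-balaban-beta-an2/gen24/K-U3d-LEAVES.v1.3205b2870f6492d5.md`
# §L3 as RE-CUT by the owner's ADDENDUM (journal l.24201: «L3 is thus: the two inverse identities … and the two `axEc`-slice identities»); over L1
# `CompositeCorrectorForms` p241443, L1b `CompositeCorrectorCovariance` p243087 (an2-g24) and L2 `CompositeCorrectorKernel` (t4-ne9-formalise-leaf-06-g32) BY NAME)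

HONEST FRAMING (cell charter, verbatim): «discharging BetaPertH makes Balaban's UV stability UNCONDITIONAL — a real
constructive-QFT result; it is NOT the continuum limit and NOT the Clay problem.»
HONEST DEPENDENCY: continuum YM on T⁴ ⇐ BetaPertH ∧ nine spine estimates (0/9 proved); BetaPertH ⇐ (D1) ∧ (D4) ∧ CAP+tail;
G-an2-4 gates asym, D1 and NE2/3/4.
ABSOLUTE RULE (cell, verbatim): «No internally-minted statement may enter as a cited fact. Every hypothesis is either kernel-proved in this
package or a verbatim quotation of a PUBLISHED theorem with page reference. The manuscript(s) under audit are NOT citable for their own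
disputed steps — they are the thing under adjudication; programme-internal (2001/route/tribunal) claims are never citable.»
NOTHING below is cited: no `[cite: …]`, no `def`, no `Prop` fact.  Every declaration is [folklore] finite-sum kernel bookkeeping over the cell's OWN typed objects
BY NAME: lit's `ExpKernelCalculus.MKer ∕ comp`, `HessKerSchurResolvent.idK`, `OneStepResolventKernel.Fib`; the lead's `TameKernelCalculus.trK`; an2's
`AxialDressingRooted.IsCombBondAt ∕ axEc ∕ comp_axEc_apply ∕ comp_axEc_apply'`, L1 `CompositeCorrectorForms.corrPsi_corrPhi ∕ corrPhi_corrPsi`, L1b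
`CompositeCorrectorCovariance.corrPsi_apply_of_blk_eq ∕ corrPhi_apply_of_blk_eq`; leaf-06-g32's L2 `CompositeCorrectorKernel.psiK ∕ phiK ∕ indR` with the entry lemmas,
`CompositeCorrectorLinear.corrPsi_zero ∕ corrPhi_zero` and THE APPLY BRIDGE `comp_psiK_inl ∕ comp_psiK_inr ∕ comp_phiK_inl ∕ comp_phiK_inr`.  It asserts nothing about
Bałaban's non-linear averages beyond their typed linearisations.

WHY (row-D1 owner an2-g24: K-U3d-SCOPE v1 §0, K-U3d-LEAVES v1 §L3∕§L4 + ADDENDUM l.24201; d1-formalise-ref I-d1ref30-2 ∕ I-d1ref31-1).  The (Z)_m END of K-U3d,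
`RelInv (Ψ̂_m ∘ coDressKBmAt (toSite s) n (KInv n) ∘ Ψ̂_mᵀ) (Φ̂_mᵀ ∘ bhK n ∘ Φ̂_m) (axEc (toSite s) n)`, follows from `RelInvBorderedHessian.relInv_coDressKBmAt_KInv` by
`relInv_congr_kernel` as soon as the corrector pair satisfies `Ψ̂∘Φ̂ = idK = Φ̂∘Ψ̂`, `(E∘Ψ̂)∘E = Ψ̂∘E`, `(E∘Φ̂)∘E = Φ̂∘E` (plus `Spr Ψ̂ ∕ Spr Φ̂`, L2 PART 2).  THIS FILE proves
exactly these four identities: the inverse pair through L2's apply bridge (the field columns of `Φ̂_m` ARE the forms `Φ_m δ_{(β,z)}`, so `comp Ψ̂ Φ̂` on a field column is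
`Ψ_m (Φ_m δ) = δ` by L1; multiplier columns are Kronecker); the slice pair entrywise from the two actions of `axEc` (comb field rows∕columns killed, non-coarse multiplier
rows∕columns killed): on a COMB bond `(α, x)` the row of `Ψ̂_m − 1` vanishes because comb bonds are intra-block (second conjunct of the LITERAL
`AxialCoordinateProjector.IsCombBondAt`, fed to L1b's `corrPsi_apply_of_blk_eq` — I-d1ref31-1), and `Ψ̂_m`'s multiplier block is the identity.

WHAT (`d+1` the lattice dimension; `L` the block side with `0 < L`, `m` levels; roots `r k ∈ box (d+1) L`; in-block root `s ∈ box (d+1) (L^m)` of the slice; all [folklore]):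
§1 **`comp_psiK_phiK (hL) (r) (hr) (m) : comp (psiK r L m) (phiK r L m) = idK`**, **`comp_phiK_psiK`**.
§2 **`comp_comp_axEc_psiK (r L m) (hs) : comp (comp (axEc (toSite s) (L^m)) (psiK r L m)) (axEc (toSite s) (L^m)) = comp (psiK r L m) (axEc (toSite s) (L^m))`**,
   **`comp_comp_axEc_phiK`** (the `hs` binder is carried for the END's bookkeeping; the identities hold for every root offset `s`).
The descriptive identification of the entries of `Φ̂_mᵀ ∘ bhK (L^m) ∘ Φ̂_m` (the owner's `bhKcomp`, defined by congruence in L4) is leaf L4b (`CompositeCorrectorBordered`).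
Provenance: β sub-cell; cross-lane idle seat `b2b-balaban-t4-ne9-formalise-leaf-09` gen 39 (prover-b2b-balaban-t4-ne9-formalise-leaf-09-g39-0), 2026-08-21 (INTENT journal
l.24020).  NOT (SDF), NOT D1, NEVER «(Z) closed» before L4 consumes `relInv_congr_kernel` BY NAME, NOT `BetaPertH`, NOT continuum, NOT Clay.
-/

namespace Summit.QuantumFields.BalabanUV.Beta.CompositeCorrectorRules

open Finset
open scoped BigOperators
open Literature.Probability.LatticeModels (Torus.proj)
open Literature.MathematicalPhysics.QuantumFieldTheory
open Literature.MathematicalPhysics.QuantumFieldTheory.Balaban1983to89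
open Literature.MathematicalPhysics.QuantumFieldTheory.Balaban1983to89.Beta
open ExpKernelCalculus (MKer comp)
open AffineAveraging (Form1 box toSite)
open OneStepResolventKernel (Fib)
open HessKerSchurResolvent (idK idK_apply)
open Summit.QuantumFields.BalabanUV.Beta.TameKernelCalculus
open Summit.QuantumFields.BalabanUV.Beta.AxialDressingRooted (IsCombBondAt axEc comp_axEc_apply comp_axEc_apply')
open Summit.QuantumFields.BalabanUV.Beta.CompositeCorrectorForms (corrPhi corrPsi corrPsi_corrPhi corrPhi_corrPsi)
open Summit.QuantumFields.BalabanUV.Beta.CompositeCorrectorCovariance (corrPsi_apply_of_blk_eq corrPhi_apply_of_blk_eq)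
open Summit.QuantumFields.BalabanUV.Beta.CompositeCorrectorLinear (corrPsi_zero corrPhi_zero)
open Summit.QuantumFields.BalabanUV.Beta.CompositeCorrectorKernel (indR psiK phiK indR_apply psiK_inl_inl psiK_inl_inr psiK_inr_inl
  psiK_inr_inr phiK_inl_inl phiK_inl_inr phiK_inr_inl phiK_inr_inr comp_psiK_inl comp_psiK_inr comp_phiK_inl comp_phiK_inr)

noncomputable section

variable {d : ℕ}

/-! ## §1 The kernel correctors are mutually inverse -/

section Inverse

variable {L : ℕ} (hL : 0 < L) (r : ℕ → (Fin (d + 1) → ℕ)) (hr : ∀ k, r k ∈ box (d + 1) L) (m : ℕ)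
include hL hr

/-- [folklore] **`Ψ̂_m ∘ Φ̂_m = 1`** (the apply bridge `comp_psiK_inl`∕`comp_psiK_inr` of L2 + the Form-level `corrPsi_corrPhi` of L1: the field columns of
`Φ̂_m` ARE the forms `Φ_m δ_{(β,z)}`). -/
theorem comp_psiK_phiK : comp (psiK r L m) (phiK r L m) = (idK : MKer (d + 1) (Fib d)) := by
  funext x z a b
  rcases a with α | μ
  · rw [comp_psiK_inl hL hr, idK_apply]
    rcases b with β | μ'
    · have hcol : (fun κ y => phiK r L m y z (Sum.inl κ) (Sum.inl β)) = corrPhi r L m (indR β z) := by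
        funext κ y; rw [phiK_inl_inl]
      rw [hcol, corrPsi_corrPhi hL r hr, indR_apply]
      by_cases h : x = z ∧ α = β
      · rw [if_pos ⟨h.2, h.1⟩, if_pos ⟨h.1, congrArg Sum.inl h.2⟩]
      · rw [if_neg (fun h' => h ⟨h'.2, h'.1⟩), if_neg (fun h' => h ⟨h'.1, Sum.inl_injective h'.2⟩)]
    · have hcol : (fun κ y => phiK r L m y z (Sum.inl κ) (Sum.inr μ')) = 0 := by
        funext κ y; rw [phiK_inl_inr]; rfl
      rw [hcol, corrPsi_zero, if_neg (fun h => Sum.inl_ne_inr h.2)]; rfl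
  · rw [comp_psiK_inr, idK_apply]
    rcases b with β | μ'
    · rw [phiK_inr_inl, if_neg (fun h => Sum.inr_ne_inl h.2)]
    · rw [phiK_inr_inr]
      by_cases h : x = z ∧ μ = μ'
      · rw [if_pos h, if_pos ⟨h.1, congrArg Sum.inr h.2⟩]
      · rw [if_neg h, if_neg (fun h' => h ⟨h'.1, Sum.inr_injective h'.2⟩)]

/-- [folklore] **`Φ̂_m ∘ Ψ̂_m = 1`**. -/
theorem comp_phiK_psiK : comp (phiK r L m) (psiK r L m) = (idK : MKer (d + 1) (Fib d)) := by
  funext x z a b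
  rcases a with α | μ
  · rw [comp_phiK_inl hL hr, idK_apply]
    rcases b with β | μ'
    · have hcol : (fun κ y => psiK r L m y z (Sum.inl κ) (Sum.inl β)) = corrPsi r L m (indR β z) := by
        funext κ y; rw [psiK_inl_inl]
      rw [hcol, corrPhi_corrPsi hL r hr, indR_apply]
      by_cases h : x = z ∧ α = β
      · rw [if_pos ⟨h.2, h.1⟩, if_pos ⟨h.1, congrArg Sum.inl h.2⟩]
      · rw [if_neg (fun h' => h ⟨h'.2, h'.1⟩), if_neg (fun h' => h ⟨h'.1, Sum.inl_injective h'.2⟩)]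
    · have hcol : (fun κ y => psiK r L m y z (Sum.inl κ) (Sum.inr μ')) = 0 := by
        funext κ y; rw [psiK_inl_inr]; rfl
      rw [hcol, corrPhi_zero, if_neg (fun h => Sum.inl_ne_inr h.2)]; rfl
  · rw [comp_phiK_inr, idK_apply]
    rcases b with β | μ'
    · rw [psiK_inr_inl, if_neg (fun h => Sum.inr_ne_inl h.2)]
    · rw [psiK_inr_inr]
      by_cases h : x = z ∧ μ = μ'
      · rw [if_pos h, if_pos ⟨h.1, congrArg Sum.inr h.2⟩]
      · rw [if_neg h, if_neg (fun h' => h ⟨h'.1, Sum.inr_injective h'.2⟩)]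

end Inverse

/-! ## §2 The correctors preserve the rooted axial (comb) slice: `(E ∘ Ψ̂) ∘ E = Ψ̂ ∘ E` for `E = axEc (toSite s) (L^m)` -/

section Slice

variable (r : ℕ → (Fin (d + 1) → ℕ)) (L m : ℕ) {s : Fin (d + 1) → ℕ}

open Classical in
/-- [folklore] **SLICE RULE FOR `Ψ̂_m`**: `(axEc ∘ Ψ̂_m) ∘ axEc = Ψ̂_m ∘ axEc` — the field rows of `Ψ̂_m − 1` on comb bonds vanish (an2's L1b `CompositeCorrectorCovariance.corrPsi_apply_of_blk_eq` on the second conjunct of the LITERAL `IsCombBondAt` — d1-formalise-ref I-d1ref31-1),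
the multiplier block is the identity (pattern `BorderedHessianRooted.comp_comp_axEc_of_combSupported`). -/
theorem comp_comp_axEc_psiK (hs : s ∈ box (d + 1) (L ^ m)) :
    comp (comp (axEc (toSite s) (L ^ m)) (psiK r L m)) (axEc (toSite s) (L ^ m)) = comp (psiK r L m) (axEc (toSite s) (L ^ m)) := by
  have _ := hs
  funext x z a b
  rw [comp_axEc_apply', comp_axEc_apply']
  rcases b with β | μ'
  · -- field column
    show (if IsCombBondAt (toSite s) (L ^ m) β z then 0 else comp (axEc (toSite s) (L ^ m)) (psiK r L m) x z a (Sum.inl β)) =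
      if IsCombBondAt (toSite s) (L ^ m) β z then 0 else psiK r L m x z a (Sum.inl β)
    by_cases hcz : IsCombBondAt (toSite s) (L ^ m) β z
    · rw [if_pos hcz, if_pos hcz]
    rw [if_neg hcz, if_neg hcz, comp_axEc_apply]
    rcases a with α | μ
    · show (if IsCombBondAt (toSite s) (L ^ m) α x then 0 else psiK r L m x z (Sum.inl α) (Sum.inl β)) =
        psiK r L m x z (Sum.inl α) (Sum.inl β)
      by_cases hcx : IsCombBondAt (toSite s) (L ^ m) α x
      · rw [if_pos hcx, psiK_inl_inl, corrPsi_apply_of_blk_eq r L m _ hcx.2, indR_apply]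
        by_cases h : α = β ∧ x = z
        · obtain ⟨rfl, rfl⟩ := h; exact absurd hcx hcz
        · rw [if_neg h]
      · rw [if_neg hcx]
    · show (if Torus.proj (L ^ m) x = 0 then psiK r L m x z (Sum.inr μ) (Sum.inl β) else 0) = psiK r L m x z (Sum.inr μ) (Sum.inl β)
      rw [psiK_inr_inl]; split_ifs <;> rfl
  · -- multiplier column
    show (if Torus.proj (L ^ m) z = 0 then comp (axEc (toSite s) (L ^ m)) (psiK r L m) x z a (Sum.inr μ') else 0) =
      if Torus.proj (L ^ m) z = 0 then psiK r L m x z a (Sum.inr μ') else 0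
    by_cases hpz : Torus.proj (L ^ m) z = 0
    · rw [if_pos hpz, if_pos hpz, comp_axEc_apply]
      rcases a with α | μ
      · show (if IsCombBondAt (toSite s) (L ^ m) α x then 0 else psiK r L m x z (Sum.inl α) (Sum.inr μ')) = psiK r L m x z (Sum.inl α) (Sum.inr μ')
        rw [psiK_inl_inr]; split_ifs <;> rfl
      · show (if Torus.proj (L ^ m) x = 0 then psiK r L m x z (Sum.inr μ) (Sum.inr μ') else 0) = psiK r L m x z (Sum.inr μ) (Sum.inr μ')
        by_cases hpx : Torus.proj (L ^ m) x = 0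
        · rw [if_pos hpx]
        · rw [if_neg hpx, psiK_inr_inr, if_neg]
          rintro ⟨rfl, -⟩
          exact hpx hpz
    · rw [if_neg hpz, if_neg hpz]

open Classical in
/-- [folklore] **SLICE RULE FOR `Φ̂_m`**: `(axEc ∘ Φ̂_m) ∘ axEc = Φ̂_m ∘ axEc`. -/
theorem comp_comp_axEc_phiK (hs : s ∈ box (d + 1) (L ^ m)) :
    comp (comp (axEc (toSite s) (L ^ m)) (phiK r L m)) (axEc (toSite s) (L ^ m)) = comp (phiK r L m) (axEc (toSite s) (L ^ m)) := by
  have _ := hs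
  funext x z a b
  rw [comp_axEc_apply', comp_axEc_apply']
  rcases b with β | μ'
  · show (if IsCombBondAt (toSite s) (L ^ m) β z then 0 else comp (axEc (toSite s) (L ^ m)) (phiK r L m) x z a (Sum.inl β)) =
      if IsCombBondAt (toSite s) (L ^ m) β z then 0 else phiK r L m x z a (Sum.inl β)
    by_cases hcz : IsCombBondAt (toSite s) (L ^ m) β z
    · rw [if_pos hcz, if_pos hcz]
    rw [if_neg hcz, if_neg hcz, comp_axEc_apply]
    rcases a with α | μ
    · show (if IsCombBondAt (toSite s) (L ^ m) α x then 0 else phiK r L m x z (Sum.inl α) (Sum.inl β)) =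
        phiK r L m x z (Sum.inl α) (Sum.inl β)
      by_cases hcx : IsCombBondAt (toSite s) (L ^ m) α x
      · rw [if_pos hcx, phiK_inl_inl, corrPhi_apply_of_blk_eq r L m _ hcx.2, indR_apply]
        by_cases h : α = β ∧ x = z
        · obtain ⟨rfl, rfl⟩ := h; exact absurd hcx hcz
        · rw [if_neg h]
      · rw [if_neg hcx]
    · show (if Torus.proj (L ^ m) x = 0 then phiK r L m x z (Sum.inr μ) (Sum.inl β) else 0) = phiK r L m x z (Sum.inr μ) (Sum.inl β)
      rw [phiK_inr_inl]; split_ifs <;> rfl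
  · show (if Torus.proj (L ^ m) z = 0 then comp (axEc (toSite s) (L ^ m)) (phiK r L m) x z a (Sum.inr μ') else 0) =
      if Torus.proj (L ^ m) z = 0 then phiK r L m x z a (Sum.inr μ') else 0
    by_cases hpz : Torus.proj (L ^ m) z = 0
    · rw [if_pos hpz, if_pos hpz, comp_axEc_apply]
      rcases a with α | μ
      · show (if IsCombBondAt (toSite s) (L ^ m) α x then 0 else phiK r L m x z (Sum.inl α) (Sum.inr μ')) = phiK r L m x z (Sum.inl α) (Sum.inr μ')
        rw [phiK_inl_inr]; split_ifs <;> rfl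
      · show (if Torus.proj (L ^ m) x = 0 then phiK r L m x z (Sum.inr μ) (Sum.inr μ') else 0) = phiK r L m x z (Sum.inr μ) (Sum.inr μ')
        by_cases hpx : Torus.proj (L ^ m) x = 0
        · rw [if_pos hpx]
        · rw [if_neg hpx, phiK_inr_inr, if_neg]
          rintro ⟨rfl, -⟩
          exact hpx hpz
    · rw [if_neg hpz, if_neg hpz]

end Slice

end

end Summit.QuantumFields.BalabanUV.Beta.CompositeCorrectorRules
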